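import Mathlib.MeasureTheory.Constructions.BorelSpace.Basic
import Mathlib.MeasureTheory.Measure.Haar.Basic
import Mathlib.Topology.Compactness.SigmaCompact
import Literature.NumberTheory.Automorphic.IdelicDyadicUnfolding
import HarnessLib

/-!
# The unit group of a locally compact monoid is a Borel space; Haar measures on the idele group

Topic `NumberTheory/Automorphic`; namespace `Literature.NumberTheory.Automorphic`. Proof file
(theorems only). Mathlib equips the units `Mˣ` of a monoid `M` with the topology induced by
`x ↦ (x, x⁻¹) ∈ M × Mᵐᵒᵖ` (`Units.instTopologicalSpace`) and, independently, with the σ-algebra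
pulled back along `Units.val : Mˣ → M` (`Units.instMeasurableSpace`); it does not record that the
latter is the Borel σ-algebra of the former. For the idele group `𝔸_Kˣ = ideleGroup K` this is the
convention of `TateLocalFactors`, `MirabolicEisensteinSeries` and `PairLFunctionPolesRankinSelberg`,
whose statements quantify over Haar measures `ν` on `𝔸_Kˣ` for that σ-algebra; to *produce* such a
`ν` (Mathlib's `Measure.haar`) one needs `BorelSpace 𝔸_Kˣ`. This file proves it:

* `borel_units_eq_comap_val` (**proved**): if `M` is a Hausdorff topological monoid whose unit
  group is locally compact and second countable, then `borel Mˣ = (borel M).comap Units.val`.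
  (`⊇`: `val` is continuous. `⊆`: an open `U ⊆ Mˣ` is σ-compact, so `val '' U` is σ-compact in the
  Hausdorff `M`, hence Borel, and `U = val ⁻¹' (val '' U)`.) Hence `borelSpace_units`:
  `Units.instMeasurableSpace` is Borel when `M` is.
* `borelSpace_ideleGroup` and `exists_isHaarMeasure_ideleGroup` (**proved**): for the Borel
  σ-algebra on `𝔸_K`, the idele group with `Units.instMeasurableSpace` is a Borel space and carries
  a Haar measure (the hypotheses for `M = 𝔸_K` are `t2Space_adeleRing`,
  `locallyCompactSpace_ideleGroup` and `secondCountableTopology_ideleGroup` of the tree).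

References: Cassels–Fröhlich, *Algebraic Number Theory*, Ch. II §16 (the idele topology);
Bourbaki, *Intégration*, Ch. VII §1 (Haar measure). All statements are folklore.
-/

noncomputable section

open MeasureTheory Topology NumberField IsDedekindDomain

namespace Literature.NumberTheory.Automorphic

/-! ### Units of a Hausdorff monoid: the pulled-back σ-algebra is Borel -/

section Units

variable {M : Type*} [Monoid M] [TopologicalSpace M]

/-- An open subset of a locally compact, second countable space of units is σ-compact (it is itself
locally compact and second countable in the subspace topology). [folklore] -/
theorem isSigmaCompact_of_isOpen_units [LocallyCompactSpace Mˣ] [SecondCountableTopology Mˣ]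
    {U : Set Mˣ} (hU : IsOpen U) : IsSigmaCompact U := by
  haveI : LocallyCompactSpace U := hU.locallyCompactSpace
  have h := (isSigmaCompact_univ (X := U)).image continuous_subtype_val
  rwa [Set.image_univ, Subtype.range_coe] at h

/-- **`borel Mˣ = (borel M).comap Units.val`** for a Hausdorff monoid `M` whose unit group (with
Mathlib's units topology, induced by `x ↦ (x, x⁻¹)`) is locally compact and second countable: the
σ-algebra `Units.instMeasurableSpace` pulled back along `Units.val` is the Borel σ-algebra of the
units topology. `⊇` since `val` is continuous; `⊆` since an open `U ⊆ Mˣ` is σ-compact, so that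
`val '' U` is σ-compact, hence Borel, in the Hausdorff space `M`, and `U = val ⁻¹' (val '' U)` by
injectivity of `val`. [folklore] -/
theorem borel_units_eq_comap_val [T2Space M] [LocallyCompactSpace Mˣ] [SecondCountableTopology Mˣ] :
    borel Mˣ = (borel M).comap (Units.val : Mˣ → M) := by
  apply le_antisymm
  · change MeasurableSpace.generateFrom {s : Set Mˣ | IsOpen s} ≤ _
    refine MeasurableSpace.generateFrom_le fun U hU => ?_
    refine ⟨Units.val '' U, ?_, Set.preimage_image_eq U Units.val_injective⟩
    letI : MeasurableSpace M := borel M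
    haveI : BorelSpace M := ⟨rfl⟩
    obtain ⟨C, hC, hCU⟩ := (isSigmaCompact_of_isOpen_units hU).image Units.continuous_val
    rw [← hCU]
    exact MeasurableSet.iUnion fun k => (hC k).measurableSet
  · exact measurable_iff_comap_le.mp Units.continuous_val.borel_measurable

/-- **The unit group of a Borel Hausdorff monoid is a Borel space** for Mathlib's
`Units.instMeasurableSpace` (pulled back along `val`), provided the unit group is locally compact
and second countable. [folklore] -/
theorem borelSpace_units [T2Space M] [LocallyCompactSpace Mˣ] [SecondCountableTopology Mˣ]
    [MeasurableSpace M] [BorelSpace M] : BorelSpace Mˣ := by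
  refine ⟨?_⟩
  rw [borel_units_eq_comap_val, ← ‹BorelSpace M›.measurable_eq]
  rfl

end Units

/-! ### The idele group -/

section Idele

variable (K : Type) [Field K] [NumberField K]

/-- **The idele group is a Borel space**: for the Borel σ-algebra on `𝔸_K`, Mathlib's pulled-back
σ-algebra `Units.instMeasurableSpace` on `𝔸_Kˣ` is the Borel σ-algebra of the idele topology
(`borelSpace_units`). [folklore] -/
theorem borelSpace_ideleGroup [MeasurableSpace (AdeleRing (𝓞 K) K)]
    [BorelSpace (AdeleRing (𝓞 K) K)] :
    BorelSpace (GaloisRepresentations.ideleGroup K) := by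
  haveI := t2Space_adeleRing K
  haveI := locallyCompactSpace_ideleGroup K
  haveI := secondCountableTopology_ideleGroup K
  exact borelSpace_units

/-- **Haar measures on the idele group exist** for the σ-algebra `Units.instMeasurableSpace` over
the Borel σ-algebra of `𝔸_K` (Mathlib's `Measure.haar` on the locally compact group `𝔸_Kˣ`, a
Borel space by `borelSpace_ideleGroup`) — the measures `ν` over which `summable_mirabolicEisenstein`
and the Rankin–Selberg hypotheses of `PairLFunctionPolesRankinSelberg` quantify. [folklore] -/
theorem exists_isHaarMeasure_ideleGroup [MeasurableSpace (AdeleRing (𝓞 K) K)]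
    [BorelSpace (AdeleRing (𝓞 K) K)] :
    ∃ ν : Measure (GaloisRepresentations.ideleGroup K), ν.IsHaarMeasure := by
  haveI := borelSpace_ideleGroup K
  haveI := locallyCompactSpace_ideleGroup K
  exact ⟨Measure.haar, inferInstance⟩

end Idele

end Literature.NumberTheory.Automorphic
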